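import Literature.AlgebraicGeometry.Resolution.TaylorOrderBound
import Literature.AlgebraicGeometry.Resolution.Dehomogenization
import Literature.AlgebraicGeometry.Resolution.BlowupChartRsop
import Literature.AlgebraicGeometry.Resolution.RegularLocalRingsNormal
import Literature.AlgebraicGeometry.Resolution.SymbolicPowersRsop
import Mathlib.RingTheory.Localization.AtPrime.Basic
import Mathlib.RingTheory.LocalRing.RingHom.Basic
import HarnessLib

/-!
# The order of the weak transform under the blowing up of a point: the charts (Cossart–Piltant 2008, (10)–(11), (a))

Topic: `Literature/AlgebraicGeometry/Resolution`. Hironaka's fundamental inequality for the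
blowing up of a closed point of a regular scheme, in the form printed in [CoP1] =
Cossart–Piltant, J. Algebra 320 (2008), proof of Prop. 4.2, p. 8:

> "(a) For any point `x′` above `x`, `ord_{x′} J′ ≤ μ` … To prove (a), let `f ∈ I` with
> `ord_x f = μ`. … `F(Y₁, Y₂, Y₃) := in_x f` … (10). In the chart of `X′` where, say
> `y₁′ := y₁` is an equation of the exceptional divisor, `y₁^{-μ} f ≡ F(1, y₂′, y₃′) mod (y₁′)`
> … (11). Now (11) proves (a), since `ord_{x′} J′ ≤ deg F = μ`."

This file PROVES the CHART form, for a regular local ring `(R, 𝔪)` of any dimension `d` with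
regular system of parameters `c = (c₁, …, c_d)` and the chart ring `B_j = (R[𝔪t])_{(c_j t)}` of
`Bl_𝔪(Spec R) = Proj R[𝔪t]` (`chartRing c j`, `BlowupChartRsop.lean`):

**Theorem** (`exists_weakTransform_chart_not_mem_pow`). Let `f ∈ 𝔪^ν ∖ 𝔪^{ν+1}`. Then
`φ(f) = φ(c_j)^ν · f′` for an `f′ ∈ B_j` (the weak transform of `f` on the chart) such that
for every prime `𝔴` of `B_j` on the exceptional divisor (`φ(c_j) ∈ 𝔴`),
`f′ ∉ 𝔴^{ν+1} (B_j)_𝔴` — i.e. `ord_𝔴 f′ ≤ ν`.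

Proof, along the printed lines: `f = F(c)` for a form `F` of degree `ν` with non-zero reduction
`F̄` (initial form; `exists_isHomogeneous_eval_eq_of_mem_pow`,
`eval_mem_pow_succ_of_map_residue_eq_zero`, `RegularLocalRingsNormal.lean`); on the chart
`φ(F(c)) = φ(c_j)^ν F(e)` (`reesChartBase_eval_eq_pow_mul_eval₂`), so `f′ = F(e)`; modulo the
exceptional divisor `B_j/(c_j) ≅ k[T_l : l ≠ j]` (`chartQuotEquiv`, `c` being quasi-regular,
`isQuasiRegular_rsop_comp` of `SymbolicPowersRsop.lean`)
and `f′ ↦ g := F̄(T_j := 1)`, a NON-ZERO polynomial (`dehomogenize_ne_zero_of_isHomogeneous`,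
`Dehomogenization.lean`) of degree `≤ ν`; a prime `𝔴 ∋ φ(c_j)` of `B_j` gives a prime `𝔮` of
`k[T]` and a local homomorphism `(B_j)_𝔴 → k[T]_𝔮` under which `f′ ∈ 𝔴^{ν+1}(B_j)_𝔴` would give
`g ∈ 𝔮^{ν+1} k[T]_𝔮`, contradicting `ord_𝔮 g ≤ deg g ≤ ν` (`TaylorOrderBound.lean`).

* `Ideal.map_maximalIdeal_pow_le` — local homomorphisms map `𝔪ⁿ` into `𝔪ⁿ`;
  `algebraMap_not_mem_maximalIdeal_pow_of_comap_eq` — orders do not drop along `B_𝔴 → P_𝔮`;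
* `totalDegree_map_le` — bookkeeping;
* `exists_isHomogeneous_eval_eq_map_residue_ne_zero` — initial forms (from
  `RegularLocalRingsNormal.lean`);
* `eval₂Hom_chartGen_not_mem_maximalIdeal_pow` — the theorem for a given initial form;
  `exists_weakTransform_chart_not_mem_pow` — packaged.

## Sources

* V. Cossart, O. Piltant, J. Algebra 320 (2008) 1051–1082, proof of Prop. 4.2, (10), (11), (a)
  (PDF p. 8). [CossartPiltant2008]
* H. Hironaka, Ann. of Math. 79 (1964), Ch. III (the order `ν` under permissible blowing ups) —
  background.
-/

noncomputable section

namespace Literature.AlgebraicGeometry.Resolution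

universe u

open IsLocalRing

/-! ## Local homomorphisms and powers of the maximal ideal -/

/-- A local homomorphism maps `𝔪_Aⁿ` into `𝔪_Bⁿ`. [folklore] -/
theorem Ideal.map_maximalIdeal_pow_le {A B : Type*} [CommRing A] [CommRing B] [IsLocalRing A]
    [IsLocalRing B] (f : A →+* B) [IsLocalHom f] (n : ℕ) :
    (maximalIdeal A ^ n).map f ≤ maximalIdeal B ^ n := by
  rw [Ideal.map_pow]
  exact Ideal.pow_right_mono (((local_hom_TFAE f).out 0 2).mp ‹_›) n

/-- Changing coefficients does not increase the total degree. [folklore] -/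
theorem totalDegree_map_le {R S : Type*} [CommSemiring R] [CommSemiring S] {σ : Type*}
    (f : R →+* S) (p : MvPolynomial σ R) :
    (MvPolynomial.map f p).totalDegree ≤ p.totalDegree :=
  Finset.sup_mono (MvPolynomial.support_map_subset f p)

/-- **Orders do not drop along a ring homomorphism, read in the localisations**: for
`ρ : B → P` and primes `𝔴 = ρ⁻¹𝔮`, if `ρ(b) ∉ 𝔮ⁿ P_𝔮` then `b ∉ 𝔴ⁿ B_𝔴` (the induced
`B_𝔴 → P_𝔮` is local). [folklore] -/
theorem algebraMap_not_mem_maximalIdeal_pow_of_comap_eq {B P : Type*} [CommRing B] [CommRing P]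
    (ρ : B →+* P) (𝔴 : Ideal B) [𝔴.IsPrime] (𝔮 : Ideal P) [𝔮.IsPrime] (h : 𝔴 = 𝔮.comap ρ)
    {b : B} {n : ℕ}
    (hb : algebraMap P (Localization.AtPrime 𝔮) (ρ b) ∉ maximalIdeal (Localization.AtPrime 𝔮) ^ n) :
    algebraMap B (Localization.AtPrime 𝔴) b ∉ maximalIdeal (Localization.AtPrime 𝔴) ^ n := by
  intro hmem
  apply hb
  rw [← Localization.localRingHom_to_map 𝔴 𝔮 ρ h]
  exact Ideal.map_maximalIdeal_pow_le (Localization.localRingHom 𝔴 𝔮 ρ h) n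
    (Ideal.mem_map_of_mem _ hmem)

/-! ## The chart computation -/

section Chart

variable {R : Type u} [CommRing R] [IsRegularLocalRing R] {d : ℕ}
  (hd : (maximalIdeal R).spanFinrank = d) (c : Fin d → R)
  (hc : Ideal.span (Set.range c) = maximalIdeal R)

include hc in
/-- **Initial forms** ([CoP1] (10): "`F(Y₁, Y₂, Y₃) := in_x f`"): an element `f ∈ 𝔪^ν ∖ 𝔪^{ν+1}`
of the (regular) local ring `R` is the value `F(c)` of a form `F` of degree `ν` in the generators `c` of `𝔪`
whose reduction `F̄` modulo `𝔪` is non-zero (`RegularLocalRingsNormal.lean`).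
[cite: CossartPiltant2008, proof of Prop. 4.2, (10)] -/
theorem exists_isHomogeneous_eval_eq_map_residue_ne_zero {f : R} {ν : ℕ}
    (hf : f ∈ maximalIdeal R ^ ν) (hf' : f ∉ maximalIdeal R ^ (ν + 1)) :
    ∃ F : MvPolynomial (Fin d) R, F.IsHomogeneous ν ∧ MvPolynomial.eval c F = f ∧
      MvPolynomial.map (Ideal.Quotient.mk (Ideal.span (Set.range c))) F ≠ 0 := by
  obtain ⟨F, hF, hFf⟩ := exists_isHomogeneous_eval_eq_of_mem_pow c hc hf
  refine ⟨F, hF, hFf, fun h0 => hf' (hFf ▸ eval_mem_pow_succ_of_map_residue_eq_zero c hc hF ?_)⟩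
  -- `F ↦ 0` modulo `(c)` iff modulo `𝔪`
  ext m
  have := congrArg (MvPolynomial.coeff m) h0
  rw [MvPolynomial.coeff_map, MvPolynomial.coeff_zero, Ideal.Quotient.eq_zero_iff_mem, hc] at this
  rw [MvPolynomial.coeff_map, MvPolynomial.coeff_zero, residue_eq_zero_iff]
  exact this

include hd hc in
/-- **[CoP1] (11) and (a), chart form: the weak transform of an element of order `ν` has order
`≤ ν` at every point of the exceptional divisor.** For a form `F` of degree `ν` in a regular
system of parameters `c` of the regular local ring `R` with non-zero reduction `F̄` modulo
`𝔪 = (c)` (so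
`f = F(c) ∈ 𝔪^ν ∖ 𝔪^{ν+1}` and `φ(f) = φ(c_j)^ν F(e)` on the chart `B_j = (R[𝔪t])_{(c_j t)}`,
`reesChartBase_eval_eq_pow_mul_eval₂`), the weak transform `f′ = F(e)` satisfies
`f′ ∉ 𝔴^{ν+1}(B_j)_𝔴` for every prime `𝔴 ∋ φ(c_j)` of `B_j`.
[cite: CossartPiltant2008, proof of Prop. 4.2, (11) and (a)] -/
theorem eval₂Hom_chartGen_not_mem_maximalIdeal_pow (j : Fin d) {F : MvPolynomial (Fin d) R}
    {ν : ℕ} (hF : F.IsHomogeneous ν)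
    (hF0 : MvPolynomial.map (Ideal.Quotient.mk (Ideal.span (Set.range c))) F ≠ 0)
    (𝔴 : Ideal (chartRing c j)) [𝔴.IsPrime] (h𝔴 : chartBase c j (c j) ∈ 𝔴) :
    (algebraMap (chartRing c j) (Localization.AtPrime 𝔴) :
        chartRing c j →+* Localization.AtPrime 𝔴)
        (MvPolynomial.eval₂Hom (chartBase c j) (fun l => chartGen c j l) F) ∉
      maximalIdeal (Localization.AtPrime 𝔴) ^ (ν + 1) := by
  classical
  intro hmem
  -- the residue field `k = R/(c) = R/𝔪` and `g = F̄(T_j := 1) ∈ k[T_l : l ≠ j]`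
  haveI hImax : (Ideal.span (Set.range c)).IsMaximal := by
    rw [hc]; exact maximalIdeal.isMaximal R
  letI : Field (R ⧸ Ideal.span (Set.range c)) := Ideal.Quotient.field _
  set g : MvPolynomial {l : Fin d // l ≠ j} (R ⧸ Ideal.span (Set.range c)) :=
    MvPolynomial.map (Ideal.Quotient.mk _) (dehomogenize j F) with hg
  have hg0 : g ≠ 0 := by
    rw [hg, map_dehomogenize]
    exact dehomogenize_ne_zero_of_isHomogeneous j (hF.map _) hF0
  have hgdeg : g.totalDegree ≤ ν :=
    (totalDegree_map_le _ _).trans ((totalDegree_dehomogenize_le j F).trans hF.totalDegree_le)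
  -- `g` is the image of `f′` modulo the exceptional divisor
  have hquot : chartQuotMap c j g = Ideal.Quotient.mk (Ideal.span {chartBase c j (c j)})
      (MvPolynomial.eval₂Hom (chartBase c j) (fun l => chartGen c j l) F) := by
    rw [hg, ← RingHom.comp_apply, chartQuotMap_comp_map, RingHom.comp_apply]
    congr 1
    exact RingHom.congr_fun (eval₂Hom_comp_aeval_kill c j) F
  -- the surjection `ρ : B_j → k[T]` with kernel `(φ c_j)`
  have hcq : IsQuasiRegular c := by
    have := isQuasiRegular_rsop_comp hd c hc id Function.injective_id
    rwa [Function.comp_id] at this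
  set K : Ideal (chartRing c j) := Ideal.span {chartBase c j (c j)} with hK
  let ρ : chartRing c j →+* MvPolynomial {l : Fin d // l ≠ j} (R ⧸ Ideal.span (Set.range c)) :=
    (chartQuotEquiv c j hcq).symm.toRingHom.comp (Ideal.Quotient.mk K)
  have hρsurj : Function.Surjective ρ :=
    (chartQuotEquiv c j hcq).symm.surjective.comp Ideal.Quotient.mk_surjective
  have hρker : RingHom.ker ρ = K := by
    ext b
    rw [RingHom.mem_ker, RingHom.comp_apply, RingEquiv.toRingHom_eq_coe, RingEquiv.coe_toRingHom,
      EmbeddingLike.map_eq_zero_iff, Ideal.Quotient.eq_zero_iff_mem]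
  have hρF : ρ (MvPolynomial.eval₂Hom (chartBase c j) (fun l => chartGen c j l) F) = g := by
    change (chartQuotEquiv c j hcq).symm (Ideal.Quotient.mk K _) = g
    rw [← hquot, ← chartQuotEquiv_apply c j hcq, RingEquiv.symm_apply_apply]
  -- the prime `𝔮 = ρ(𝔴)` of `k[T]` and the local homomorphism `(B_j)_𝔴 → k[T]_𝔮`
  have hK𝔴 : K ≤ 𝔴 := by
    rw [hK, Ideal.span_singleton_le_iff_mem]
    exact h𝔴
  haveI h𝔮 : (𝔴.map ρ).IsPrime := Ideal.map_isPrime_of_surjective hρsurj (by rwa [hρker])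
  have hcomap : 𝔴 = (𝔴.map ρ).comap ρ := by
    rw [Ideal.comap_map_of_surjective ρ hρsurj, ← RingHom.ker_eq_comap_bot, hρker,
      sup_eq_left.mpr hK𝔴]
  have hb := algebraMap_mvPolynomial_not_mem_maximalIdeal_pow (𝔴.map ρ)
    (Localization.AtPrime (𝔴.map ρ)) hg0 (Nat.lt_succ_of_le hgdeg)
  rw [← hρF] at hb
  exact algebraMap_not_mem_maximalIdeal_pow_of_comap_eq ρ 𝔴 (𝔴.map ρ) hcomap hb hmem

include hd hc in
/-- The packaged form: for `f ∈ 𝔪^ν ∖ 𝔪^{ν+1}` there is a weak transform `f′` on the chart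
`B_j`, `φ(f) = φ(c_j)^ν f′`, of order `≤ ν` at every prime of `B_j` on the exceptional divisor.
[cite: CossartPiltant2008, proof of Prop. 4.2, (11) and (a)] -/
theorem exists_weakTransform_chart_not_mem_pow (j : Fin d) {f : R} {ν : ℕ}
    (hf : f ∈ maximalIdeal R ^ ν) (hf' : f ∉ maximalIdeal R ^ (ν + 1))
    (𝔴 : Ideal (chartRing c j)) [𝔴.IsPrime] (h𝔴 : chartBase c j (c j) ∈ 𝔴) :
    ∃ f' : chartRing c j, chartBase c j f = chartBase c j (c j) ^ ν * f' ∧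
      (algebraMap (chartRing c j) (Localization.AtPrime 𝔴) :
        chartRing c j →+* Localization.AtPrime 𝔴) f' ∉
        maximalIdeal (Localization.AtPrime 𝔴) ^ (ν + 1) := by
  obtain ⟨F, hF, hFf, hF0⟩ := exists_isHomogeneous_eval_eq_map_residue_ne_zero c hc hf hf'
  refine ⟨MvPolynomial.eval₂Hom (chartBase c j) (fun l => chartGen c j l) F, ?_,
    eval₂Hom_chartGen_not_mem_maximalIdeal_pow hd c hc j hF hF0 𝔴 h𝔴⟩
  rw [← hFf]
  exact reesChartBase_eval_eq_pow_mul_eval₂ c j hF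

end Chart

end Literature.AlgebraicGeometry.Resolution

end
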